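import Mathlib
import Summits.MatrixMultiplication.MatrixMultiplication.Theses.FidelityWitnesses

/-!
# `FidelityWitnesses.SixEighthsAtFive` (stmt-MatrixMultiplication-14040) — the constant `6` is sharp

Bini's approximate scheme (Bini–Capovani–Lotti–Romani 1979; Landsberg 2017, (2.1.2)) WITHOUT the
limit is, for every real `t`, an honest sum of five triads `S_t` with

  `Σ S_t · ⟨2,2,2⟩ = 6 t`  and  `Σ |S_t|² = 6 t² + 4 t⁴`

(`S_t = t · M_red + t² · R`, `M_red = ⟨2,2,2⟩` minus the two `a₂₂`-terms, `R` four unit entries off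
the support of `⟨2,2,2⟩`).  Hence the fidelity ratio of rank-`≤ 5` tensors takes the values
`36 t² / (6 t² + 4 t⁴) = 6 / (1 + 2t²/3) ↑ 6`, so NO constant below `6` can replace `6` in
`SixEighthsAtFive` (`sixEighthsAtFive_not_strengthened`): the item, if true, is sharp, and sharp only
in the limit `t → 0` along a border-rank-5 curve (the sup `M(2,5) = 6` is not attained by the scheme).
Slots as in the route file: `S a b c`, `a = (κ,ν)` output, `b = (κ,μ)`, `c = (μ,ν)`.
-/

set_option linter.dupNamespace false

namespace Summit.MatrixMultiplication.MatrixMultiplication.Theorems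

open scoped BigOperators
open Literature.Computability.AlgebraicComplexity

/-- **Bini's family, exact moments.** For every real `t` there is a tensor `S` of rank `≤ 5` in the
`2 × 2` format (Bini's five products at parameter `t`, Landsberg 2017 (2.1.2), indices shifted to
`Fin 2`) with `Σ S·⟨2,2,2⟩ = 6t` and `Σ‖S‖² = 6t² + 4t⁴`. [cite: Landsberg2017, (2.1.2)] -/
theorem sixEighthsAtFive_biniFamily (t : ℝ) :
    ∃ S : (Fin 2 × Fin 2) → (Fin 2 × Fin 2) → (Fin 2 × Fin 2) → ℂ,
      tensorRank S ≤ 5 ∧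
      (∑ a, ∑ b, ∑ c, S a b c * matMulTensor ℂ 2 2 2 a b c) = 6 * (t : ℂ) ∧
      (∑ a, ∑ b, ∑ c, ‖S a b c‖ ^ 2) = 6 * t ^ 2 + 4 * t ^ 4 := by
  -- indicator of one index pair
  let d : Fin 2 → Fin 2 → (Fin 2 × Fin 2) → ℂ := fun i j p => if p = (i, j) then 1 else 0
  -- the five output factors `W l`, left factors `X l`, right factors `Y l`
  let W : Fin 5 → (Fin 2 × Fin 2) → ℂ :=
    ![d 0 1, fun a => d 0 0 a + t * d 1 0 a, fun a => d 0 0 a + d 0 1 a + t * d 1 1 a, d 0 0,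
      fun a => d 0 0 a + t * d 1 1 a]
  let X : Fin 5 → (Fin 2 × Fin 2) → ℂ :=
    ![fun b => d 0 1 b + t * d 0 0 b, fun b => d 1 0 b + t * d 0 0 b, fun b => -d 0 1 b,
      fun b => -d 1 0 b, fun b => d 0 1 b + d 1 0 b]
  let Y : Fin 5 → (Fin 2 × Fin 2) → ℂ :=
    ![fun c => d 0 1 c + t * d 1 1 c, d 0 0, d 0 1, fun c => d 0 0 c + d 0 1 c + t * d 1 0 c,
      fun c => d 0 1 c + t * d 1 0 c]
  refine ⟨fun a b c => ∑ l, W l a * X l b * Y l c, ?_, ?_, ?_⟩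
  · refine tensorRank_le_of_eq_sum W X Y ?_
    funext a b c
    simp [Finset.sum_apply, triad_apply]
  · simp [W, X, Y, d, Fin.sum_univ_five, Fintype.sum_prod_type, Fin.sum_univ_two, matMulTensor]
    ring
  · simp [W, X, Y, d, Fin.sum_univ_five, Fintype.sum_prod_type, Fin.sum_univ_two, Complex.sq_norm,
      Complex.normSq_apply]
    ring

/-- **Tightness of `SixEighthsAtFive`.** For every `ε > 0` some tensor of rank `≤ 5` has fidelity
ratio above `6 − ε` with `⟨2,2,2⟩`: take Bini's scheme at `t = √ε / 2`, where
`‖Σ S·T‖² = 36 t² = 9ε` and `(6 − ε) · Σ‖S‖² = (6 − ε)(6t² + 4t⁴) = 9ε − ε³/4`. [folklore] -/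
theorem sixEighthsAtFive_tight (ε : ℝ) (hε : 0 < ε) :
    ∃ S : (Fin 2 × Fin 2) → (Fin 2 × Fin 2) → (Fin 2 × Fin 2) → ℂ,
      tensorRank S ≤ 5 ∧
      (6 - ε) * (∑ a, ∑ b, ∑ c, ‖S a b c‖ ^ 2) <
        ‖∑ a, ∑ b, ∑ c, S a b c * matMulTensor ℂ 2 2 2 a b c‖ ^ 2 := by
  obtain ⟨S, hr, hov, hn⟩ := sixEighthsAtFive_biniFamily (Real.sqrt ε / 2)
  refine ⟨S, hr, ?_⟩
  rw [hov, hn]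
  have ht2 : (Real.sqrt ε / 2) ^ 2 = ε / 4 := by
    rw [div_pow, Real.sq_sqrt hε.le]; norm_num
  have ht4 : (Real.sqrt ε / 2) ^ 4 = (ε / 4) ^ 2 := by
    rw [show (4 : ℕ) = 2 * 2 from rfl, pow_mul, ht2]
  have hnorm : ‖(6 : ℂ) * ((Real.sqrt ε / 2 : ℝ) : ℂ)‖ ^ 2 = 36 * (ε / 4) := by
    rw [norm_mul, Complex.norm_real, Real.norm_eq_abs, mul_pow, sq_abs, ht2]
    norm_num
  rw [hnorm, ht2, ht4]
  have key : 36 * (ε / 4) - (6 - ε) * (6 * (ε / 4) + 4 * (ε / 4) ^ 2) = ε ^ 3 / 4 := by ring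
  have h3 : 0 < ε ^ 3 := pow_pos hε 3
  linarith

/-- **`SixEighthsAtFive` cannot be strengthened**: no constant `c < 6` bounds the fidelity of all
rank-`≤ 5` tensors with `⟨2,2,2⟩` (`M(2,5) ≥ 6`, Bini).  So the support item `M(2,5) ≤ 6` is, if true,
SHARP, with the sup approached only along Bini's border-rank-5 curve. [folklore] -/
theorem sixEighthsAtFive_not_strengthened (c : ℝ) (hc : c < 6) :
    ¬ ∀ S : (Fin 2 × Fin 2) → (Fin 2 × Fin 2) → (Fin 2 × Fin 2) → ℂ, tensorRank S ≤ 5 →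
      ‖∑ a, ∑ b, ∑ c, S a b c * matMulTensor ℂ 2 2 2 a b c‖ ^ 2 ≤
        c * ∑ a, ∑ b, ∑ c, ‖S a b c‖ ^ 2 := by
  intro h
  obtain ⟨S, hr, hlt⟩ := sixEighthsAtFive_tight (6 - c) (by linarith)
  have h' := h S hr
  have : (6 - (6 - c)) = c := by ring
  rw [this] at hlt
  linarith

end Summit.MatrixMultiplication.MatrixMultiplication.Theorems
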